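import Mathlib
import Literature.NumberTheory.Transcendental.KZProduct
import Literature.NumberTheory.Transcendental.KZCalculusOver
import Summits.KontsevichZagierPeriods.KontsevichZagierPeriods.Theorems.SoloInformedDiscCancellation
import Summits.KontsevichZagierPeriods.KontsevichZagierPeriods.Theorems.SoloInformedRealParamInjective
import HarnessLib

/-!
# Disc cylinders over `ℝ` and the transfer of `π`-cancellation from `KZ_ℝ` to `KZ_ℚ`

File of the solo-informed residency (s210).  The real-coefficient calculus `KZ_ℝ`
(`KZOver.IntegralRep ℝ`, `KZOver.relations ℝ`: the four Kontsevich–Zagier moves with REAL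
semialgebraic data, Cresson–Viu-Sos) has no product in the tree, so the two corollaries of the
injectivity `P_ℚ ↪ P_ℝ` (`soloInformed_baseChange_mem_relations_iff_prep`, file
`SoloInformedRealParamInjective`) that concern multiplication by the disc `[D̄] = [π]` were so far
statements on paper only.  This file supplies the one product that is needed — the **disc
cylinder** `D̄ × [τ, g] = [D̄ × τ, 1 ⊗ g]` of a real-semialgebraic integral representation, in
dimension `2 + m` (no Tarski–Seidenberg: the factor has integrand `1`) — the induced additive map
`soloInformedDiscMul : FormalRep ℝ →+ FormalRep ℝ` ("multiplication by `[π]`"), and proves: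

* `soloInformed_discCyl_ofKZOver` — on base changes of KZ's representations the disc cylinder IS
  KZ's product `piRep.prod`; `soloInformed_discMul_baseChange_equivKZ` — `discMul` intertwines
  `c ↦ [π] · c` on `KZ.FormalRep` along `baseChange ℚ ℝ ∘ equivKZ`.
* `SoloInformedPiCancellationReal` (`[π]` is a non-zero-divisor on `FormalRep ℝ ⧸ relations ℝ`,
  i.e. `Q_ℝ` of the residency's verdict, OPEN) and **`PiCanc_ℝ ⇒ PiCanc_ℚ`**:
  `soloInformed_piCancellation_of_real_prep` — conditional only on the vendored Lion–Rolin
  preparation fact `semialgebraicPreparation`, real `π`-cancellation implies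
  `KZ.PiCancellation`; on `ℚ`-data the two are EQUIVALENT
  (`soloInformed_piCancellationRealOnRat_iff_prep`).
* `SoloInformedDiscCancellationRungReal d` (disc cancellation for real volume representations by
  `KZ_ℝ`-chains) and **`DiscCanc_{ℝ,d}|_{ℚ-data} ⟺ DiscCanc_{ℚ,d}`**:
  `soloInformed_discCancellationRungRealOnRat_iff_prep`, hence
  `soloInformed_discCancellationRung_of_real_prep` (`DiscCanc_{ℝ,d} ⇒ DiscCanc_{ℚ,d}`);
  `soloInformed_discCancellationRungReal_of_piCancellationReal` (`PiCanc_ℝ ⇒ DiscCanc_{ℝ,d}`).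
* `soloInformed_value_discCyl` — `value (D̄ × [τ, g]) = π · value [τ, g]` (Fubini).

So a coefficient-uniform cancellation construction over `ℝ` would prove `KZ.PiCancellation`
(residual (2) of the verdict), in the kernel; nothing here decides `Q_ℝ`.

References: M. Kontsevich, D. Zagier, *Periods* (2001), §1.1 (1), §1.2, §4.1; J. Cresson,
J. Viu-Sos, JTNB 34 (2022), §1; J.-M. Lion, J.-P. Rolin, Ann. Inst. Fourier 47 (1997) (the
preparation theorem behind `semialgebraicPreparation`).
-/

noncomputable section

open Set MeasureTheory
open Literature.ModelTheory.ExponentialFields Literature.NumberTheory.Transcendental KZ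

namespace Summit.KontsevichZagierPeriods.KontsevichZagierPeriods.Theorems

variable {m d : ℕ}

/-! ### The disc cylinder of a real-semialgebraic integral representation -/

/-- The domain `D̄ × τ ⊆ ℝ²⁺ᵐ` of the disc cylinder over `[τ, g]`: unit disc in the two leading
coordinates, `τ` in the trailing `m`. -/
def soloInformedDiscCylDomain (s : KZOver.IntegralRep ℝ m) : Set (Fin (2 + m) → ℝ) :=
  {z | (fun i => z (Fin.castAdd m i)) ∈ piDisc ∧ (fun j => z (Fin.natAdd 2 j)) ∈ s.domain}

/-- The integrand `1 ⊗ g : z ↦ g (z|ᵐ)` of the disc cylinder over `[τ, g]`. -/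
def soloInformedDiscCylFun (s : KZOver.IntegralRep ℝ m) : (Fin (2 + m) → ℝ) → ℝ :=
  fun z => s.integrand fun j => z (Fin.natAdd 2 j)

/-- Membership in the disc-cylinder domain. -/
@[simp] theorem soloInformed_mem_discCylDomain (s : KZOver.IntegralRep ℝ m) (z : Fin (2 + m) → ℝ) :
    z ∈ soloInformedDiscCylDomain s ↔
      (fun i => z (Fin.castAdd m i)) ∈ piDisc ∧ (fun j => z (Fin.natAdd 2 j)) ∈ s.domain :=
  Iff.rfl

/-- Unfolding the disc-cylinder integrand. -/
@[simp] theorem soloInformed_discCylFun_apply (s : KZOver.IntegralRep ℝ m) (z : Fin (2 + m) → ℝ) :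
    soloInformedDiscCylFun s z = s.integrand (fun j => z (Fin.natAdd 2 j)) :=
  rfl

/-- The disc-cylinder domain is `ℝ`-semialgebraic (two coordinate cylinders; the disc is even
`ℚ`-semialgebraic). -/
theorem soloInformed_isSemialgebraic_discCylDomain (s : KZOver.IntegralRep ℝ m) :
    IsSemialgebraic ℝ (soloInformedDiscCylDomain s) :=
  ((isSemialgebraic_piDisc.baseChange ℝ).preimage_comp (Fin.castAdd m)).inter
    (s.isSemialgebraic_domain.preimage_comp (Fin.natAdd 2))

/-- The disc-cylinder integrand `1 ⊗ g` is an `ℝ`-semialgebraic function on `D̄ × τ` (a coordinate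
preimage of the graph of `g`; no Tarski–Seidenberg). -/
theorem soloInformed_isSemialgebraicFunOn_discCylFun (s : KZOver.IntegralRep ℝ m) :
    IsSemialgebraicFunOn ℝ (soloInformedDiscCylDomain s) (soloInformedDiscCylFun s) := by
  rw [isSemialgebraicFunOn_iff]
  let ρ : Fin (m + 1) → Fin (2 + m + 1) :=
    Fin.lastCases (Fin.last (2 + m)) fun j => Fin.castSucc (Fin.natAdd 2 j)
  have hΓ := (isSemialgebraicFunOn_iff.mp s.isSemialgebraicFunOn_integrand).preimage_comp ρ
  convert (soloInformed_isSemialgebraic_discCylDomain s).setOf_init_mem.inter hΓ using 1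
  have hinit : ∀ w : Fin (2 + m + 1) → ℝ,
      Fin.init (w ∘ ρ) = fun j => Fin.init w (Fin.natAdd 2 j) := by
    intro w; ext j; simp [Fin.init, ρ]
  have hlast : ∀ w : Fin (2 + m + 1) → ℝ, (w ∘ ρ) (Fin.last m) = w (Fin.last (2 + m)) := by
    intro w; simp [ρ]
  ext w
  simp only [mem_setOf_eq, mem_inter_iff, mem_preimage, hinit, hlast,
    soloInformed_mem_discCylDomain, soloInformed_discCylFun_apply]
  tauto

/-- Under `Fin.append`, the disc-cylinder domain is the set-theoretic product `D̄ ×ˢ τ`. [folklore] -/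
theorem soloInformed_preimage_discCylDomain (s : KZOver.IntegralRep ℝ m) :
    KZ.appendMeasurableEquiv 2 m ⁻¹' soloInformedDiscCylDomain s = piDisc ×ˢ s.domain := by
  ext p
  simp

/-- **Tonelli.** `1 ⊗ g` is absolutely integrable on `D̄ × τ`. -/
theorem soloInformed_integrableOn_discCylFun (s : KZOver.IntegralRep ℝ m) :
    IntegrableOn (soloInformedDiscCylFun s) (soloInformedDiscCylDomain s) := by
  have hint : IntegrableOn
      (fun p : (Fin 2 → ℝ) × (Fin m → ℝ) => piRep.integrand p.1 * s.integrand p.2)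
      (piDisc ×ˢ s.domain) := by
    rw [IntegrableOn, Measure.volume_eq_prod, ← Measure.prod_restrict]
    exact piRep.integrableOn.mul_prod s.integrableOn
  have hcomp : soloInformedDiscCylFun s ∘ KZ.appendMeasurableEquiv 2 m =
      fun p => piRep.integrand p.1 * s.integrand p.2 := by
    funext p
    simp [soloInformedDiscCylFun]
  rw [← soloInformed_preimage_discCylDomain, ← hcomp] at hint
  exact (KZ.volume_preserving_appendMeasurableEquiv.integrableOn_comp_preimage
    (KZ.appendMeasurableEquiv 2 m).measurableEmbedding).mp hint

/-- **The disc cylinder** `D̄ × [τ, g] = [D̄ × τ, 1 ⊗ g] : IntegralRep ℝ (2 + m)` over a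
real-semialgebraic integral representation `[τ, g]` — multiplication by `[π] = [D̄, 1]`
(Kontsevich–Zagier 2001, §1.1 (1)) in the real-coefficient calculus `KZ_ℝ`. -/
def soloInformedDiscCyl (s : KZOver.IntegralRep ℝ m) : KZOver.IntegralRep ℝ (2 + m) where
  domain := soloInformedDiscCylDomain s
  integrand := soloInformedDiscCylFun s
  isSemialgebraic_domain := soloInformed_isSemialgebraic_discCylDomain s
  isSemialgebraicFunOn_integrand := soloInformed_isSemialgebraicFunOn_discCylFun s
  integrableOn := soloInformed_integrableOn_discCylFun s

/-- The domain of the disc cylinder. -/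
@[simp] theorem soloInformed_discCyl_domain (s : KZOver.IntegralRep ℝ m) :
    (soloInformedDiscCyl s).domain = soloInformedDiscCylDomain s := rfl

/-- The integrand of the disc cylinder. -/
@[simp] theorem soloInformed_discCyl_integrand (s : KZOver.IntegralRep ℝ m) :
    (soloInformedDiscCyl s).integrand = soloInformedDiscCylFun s := rfl

/-- **Fubini**: `value (D̄ × [τ, g]) = π · value [τ, g]`. -/
theorem soloInformed_value_discCyl (s : KZOver.IntegralRep ℝ m) :
    (soloInformedDiscCyl s).value = Real.pi * s.value := by
  rw [KZOver.IntegralRep.value, soloInformed_discCyl_domain, soloInformed_discCyl_integrand,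
    ← KZ.volume_preserving_appendMeasurableEquiv.setIntegral_preimage_emb
      (KZ.appendMeasurableEquiv 2 m).measurableEmbedding,
    soloInformed_preimage_discCylDomain]
  have hcomp : ∀ p : (Fin 2 → ℝ) × (Fin m → ℝ),
      soloInformedDiscCylFun s (KZ.appendMeasurableEquiv 2 m p) =
        piRep.integrand p.1 * s.integrand p.2 := by
    intro p; simp [soloInformedDiscCylFun]
  simp_rw [hcomp]
  rw [Measure.volume_eq_prod, setIntegral_prod_mul, ← piRep_value]
  rfl

/-- **On `ℚ`-data the disc cylinder is Kontsevich–Zagier's product**: for a KZ representation `K`,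
`D̄ × (K ⊗ ℝ) = ([π] · [K]) ⊗ ℝ` as real integral representations. -/
theorem soloInformed_discCyl_ofKZOver (K : KZ.IntegralRep m) :
    soloInformedDiscCyl (KZOver.IntegralRep.ofKZOver ℝ K) =
      KZOver.IntegralRep.ofKZOver ℝ (piRep.prod K) := by
  refine KZOver.IntegralRep.ext ?_ ?_
  · ext z
    simp [KZ.IntegralRep.prodDomain]
  · funext z
    simp [KZ.IntegralRep.prodFun]

/-! ### Multiplication by `[π]` on `FormalRep ℝ` -/

/-- **Multiplication by `[π]`** on formal `ℤ`-combinations of real integral representations: the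
additive map induced by the disc cylinder on generators. -/
def soloInformedDiscMul : KZOver.FormalRep ℝ →+ KZOver.FormalRep ℝ :=
  FreeAbelianGroup.map fun r => ⟨2 + r.1, soloInformedDiscCyl r.2⟩

/-- `discMul` on a generator. -/
@[simp] theorem soloInformed_discMul_of (s : KZOver.IntegralRep ℝ m) :
    soloInformedDiscMul (KZOver.of s) = KZOver.of (soloInformedDiscCyl s) := rfl

/-- `discMul ([K] − [K']) = [D̄ × K] − [D̄ × K']`. -/
theorem soloInformed_discMul_of_sub (K K' : KZOver.IntegralRep ℝ d) :
    soloInformedDiscMul (KZOver.of K - KZOver.of K') =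
      KZOver.of (soloInformedDiscCyl K) - KZOver.of (soloInformedDiscCyl K') := by
  rw [map_sub, soloInformed_discMul_of, soloInformed_discMul_of]

/-- **Naturality**: `discMul` intertwines Kontsevich–Zagier's `c ↦ [π] · c` along the inclusion
`KZ_ℚ ⊆ KZ_ℝ` (`baseChange ℚ ℝ ∘ equivKZ`). -/
theorem soloInformed_discMul_baseChange_equivKZ (c : KZ.FormalRep) :
    soloInformedDiscMul (KZOver.baseChange ℚ ℝ (KZOver.equivKZ c)) =
      KZOver.baseChange ℚ ℝ (KZOver.equivKZ (of piRep * c)) := by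
  have h : soloInformedDiscMul.comp ((KZOver.baseChange ℚ ℝ).comp KZOver.equivKZ.toAddMonoidHom) =
      ((KZOver.baseChange ℚ ℝ).comp KZOver.equivKZ.toAddMonoidHom).comp
        (FormalRep.mul (of piRep)) :=
    FreeAbelianGroup.lift_ext _ _ fun ⟨n, K⟩ => by
      simp only [AddMonoidHom.coe_comp, Function.comp_apply, AddEquiv.coe_toAddMonoidHom,
        FormalRep.mul_apply]
      change soloInformedDiscMul (KZOver.baseChange ℚ ℝ (KZOver.equivKZ (of K))) =
        KZOver.baseChange ℚ ℝ (KZOver.equivKZ (of piRep * of K))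
      rw [of_mul_of, KZOver.equivKZ_of, KZOver.equivKZ_of, KZOver.baseChange_of,
        KZOver.baseChange_of, soloInformed_discMul_of, soloInformed_discCyl_ofKZOver]
  exact DFunLike.congr_fun h c

/-! ### `π`-cancellation in `KZ_ℝ` and its transfer to `KZ_ℚ` -/

/-- **`π`-cancellation in `KZ_ℝ`** (the question `Q_ℝ` of the residency's verdict, OPEN): `[π]` is
a non-zero-divisor on `FormalRep ℝ ⧸ relations ℝ` — if `[π] · c` is a chain of the four moves with
real-semialgebraic data, so is `c`.
(Posed by this file as a definition / open statement of the residency; not a result in print.) -/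
def SoloInformedPiCancellationReal : Prop :=
  ∀ c : KZOver.FormalRep ℝ, soloInformedDiscMul c ∈ KZOver.relations ℝ → c ∈ KZOver.relations ℝ

/-- **`π`-cancellation by `KZ_ℝ`-chains on `ℚ`-data**: for formal combinations `c` of KZ's own
representations, a `KZ_ℝ`-chain for `[π] · c` yields a `KZ_ℝ`-chain for `c`.
(Posed by this file as a definition / open statement of the residency; not a result in print.) -/
def SoloInformedPiCancellationRealOnRat : Prop :=
  ∀ c : KZ.FormalRep,
    KZOver.baseChange ℚ ℝ (KZOver.equivKZ (of piRep * c)) ∈ KZOver.relations ℝ →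
      KZOver.baseChange ℚ ℝ (KZOver.equivKZ c) ∈ KZOver.relations ℝ

/-- Real `π`-cancellation restricts to `ℚ`-data (unconditional). -/
theorem soloInformed_piCancellationRealOnRat_of_real (h : SoloInformedPiCancellationReal) :
    SoloInformedPiCancellationRealOnRat := fun c hc =>
  h _ (by rwa [soloInformed_discMul_baseChange_equivKZ])

/-- **On `ℚ`-data, `π`-cancellation by `KZ_ℝ`-chains is `KZ.PiCancellation`**, conditional on the
preparation fact (through `P_ℚ ↪ P_ℝ`, `soloInformed_kz_baseChange_mem_relations_iff_prep`). -/
theorem soloInformed_piCancellationRealOnRat_iff_prep (hprep : semialgebraicPreparation) :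
    SoloInformedPiCancellationRealOnRat ↔ PiCancellation := by
  unfold SoloInformedPiCancellationRealOnRat PiCancellation
  simp only [soloInformed_kz_baseChange_mem_relations_iff_prep hprep]

/-- **`PiCanc_ℝ ⇒ PiCanc_ℚ`.** Conditional on the preparation fact: if `[π]` is a
non-zero-divisor in the real-coefficient calculus `KZ_ℝ`, then `KZ.PiCancellation` holds — a
coefficient-uniform cancellation construction over `ℝ` would settle residual (2). -/
theorem soloInformed_piCancellation_of_real_prep (hprep : semialgebraicPreparation)
    (h : SoloInformedPiCancellationReal) : PiCancellation :=
  (soloInformed_piCancellationRealOnRat_iff_prep hprep).mp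
    (soloInformed_piCancellationRealOnRat_of_real h)

/-! ### Disc cancellation rungs in `KZ_ℝ` and their transfer -/

/-- A real *volume representation*: compact domain with non-empty interior, integrand `1` on it.
(Posed by this file as a definition / open statement of the residency; not a result in print.) -/
def SoloInformedIsVolumeRepReal (K : KZOver.IntegralRep ℝ d) : Prop :=
  IsCompact K.domain ∧ (interior K.domain).Nonempty ∧ ∀ x ∈ K.domain, K.integrand x = 1

/-- Base change does not change being a volume representation. -/
theorem soloInformed_isVolumeRepReal_ofKZOver_iff (K : KZ.IntegralRep d) :
    SoloInformedIsVolumeRepReal (KZOver.IntegralRep.ofKZOver ℝ K) ↔ SoloInformedIsVolumeRep K :=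
  Iff.rfl

/-- **Disc cancellation at rung `d` in `KZ_ℝ`**: for real volume representations `K, K'` of
dimension `d`, if the disc cylinders `D̄ × K`, `D̄ × K'` are `KZ_ℝ`-equivalent then so are `K, K'`.
(Posed by this file as a definition / open statement of the residency; not a result in print.) -/
def SoloInformedDiscCancellationRungReal (d : ℕ) : Prop :=
  ∀ K K' : KZOver.IntegralRep ℝ d, SoloInformedIsVolumeRepReal K → SoloInformedIsVolumeRepReal K' →
    KZOver.Equivalent (soloInformedDiscCyl K) (soloInformedDiscCyl K') → KZOver.Equivalent K K'

/-- **Disc cancellation at rung `d` by `KZ_ℝ`-chains on `ℚ`-data**: the same for base changes of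
KZ's volume representations.
(Posed by this file as a definition / open statement of the residency; not a result in print.) -/
def SoloInformedDiscCancellationRungRealOnRat (d : ℕ) : Prop :=
  ∀ K K' : KZ.IntegralRep d, SoloInformedIsVolumeRep K → SoloInformedIsVolumeRep K' →
    KZOver.Equivalent (soloInformedDiscCyl (KZOver.IntegralRep.ofKZOver ℝ K))
        (soloInformedDiscCyl (KZOver.IntegralRep.ofKZOver ℝ K')) →
      KZOver.Equivalent (KZOver.IntegralRep.ofKZOver ℝ K) (KZOver.IntegralRep.ofKZOver ℝ K')

/-- Real disc cancellation restricts to `ℚ`-data (unconditional). [cite: KontsevichZagier2001, §1.2] -/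
theorem soloInformed_discCancellationRungRealOnRat_of_real (h : SoloInformedDiscCancellationRungReal d) :
    SoloInformedDiscCancellationRungRealOnRat d :=
  fun _ _ hK hK' hE => h _ _ hK hK' hE

/-- **`DiscCanc_{ℝ,d}|_{ℚ-data} ⟺ DiscCanc_{ℚ,d}`**, conditional on the preparation fact: on base
changes of KZ's volume representations, disc cancellation by `KZ_ℝ`-chains is exactly the disc
cancellation rung `SoloInformedDiscCancellationRung d` of KZ's calculus (THEOREM T for pairs,
`soloInformed_kzEquivalent_iff_real_prep`, and `soloInformed_discCyl_ofKZOver`).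
[cite: KontsevichZagier2001, §1.2] -/
theorem soloInformed_discCancellationRungRealOnRat_iff_prep (hprep : semialgebraicPreparation) :
    SoloInformedDiscCancellationRungRealOnRat d ↔ SoloInformedDiscCancellationRung d := by
  unfold SoloInformedDiscCancellationRungRealOnRat SoloInformedDiscCancellationRung
  simp only [soloInformed_discCyl_ofKZOver, soloInformed_kzEquivalent_iff_real_prep hprep]

/-- **`DiscCanc_{ℝ,d} ⇒ DiscCanc_{ℚ,d}`**, conditional on the preparation fact.
[cite: KontsevichZagier2001, §1.2] -/
theorem soloInformed_discCancellationRung_of_real_prep (hprep : semialgebraicPreparation)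
    (h : SoloInformedDiscCancellationRungReal d) : SoloInformedDiscCancellationRung d :=
  (soloInformed_discCancellationRungRealOnRat_iff_prep hprep).mp
    (soloInformed_discCancellationRungRealOnRat_of_real h)

/-- **`PiCanc_ℝ ⇒ DiscCanc_{ℝ,d}`** for every `d` (unconditional): `discMul ([K] − [K'])` is
`[D̄ × K] − [D̄ × K']`. [cite: KontsevichZagier2001, §1.2] -/
theorem soloInformed_discCancellationRungReal_of_piCancellationReal
    (h : SoloInformedPiCancellationReal) (d : ℕ) : SoloInformedDiscCancellationRungReal d := by
  intro K K' _ _ hE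
  refine h (KZOver.of K - KZOver.of K') ?_
  rw [soloInformed_discMul_of_sub]
  exact hE

/-- **`PiCanc_ℝ ⇒ DiscCanc_{ℚ,d}`** for every `d`, conditional on the preparation fact.
[cite: KontsevichZagier2001, §1.2] -/
theorem soloInformed_discCancellationRung_of_piCancellationReal_prep
    (hprep : semialgebraicPreparation) (h : SoloInformedPiCancellationReal) (d : ℕ) :
    SoloInformedDiscCancellationRung d :=
  soloInformed_discCancellationRung_of_real_prep hprep
    (soloInformed_discCancellationRungReal_of_piCancellationReal h d)

end Summit.KontsevichZagierPeriods.KontsevichZagierPeriods.Theorems
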